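import Summits.Ventures.YMGap.RobustBall.RobustAreaLawVertex
import Summits.Ventures.YMGap.RobustBall.RectangleWitness
import HarnessLib

/-!
# Robust ball (Y2), area-law side — monotonicity of the currency and the RADIUS FUNCTION on the whole `SU(2)` window

HONEST FRAMING: venture file of the cell `pub-ymgap` (QuantumFields programme), track ROBUST-BALL, seat rb-p2 (g2).  Strong-coupling LATTICE
statements on finite tori, uniform in the size; nothing about the continuum, a mass gap, or Clay.

CONTENT.
1. `AreaLawOnBall N d β ε₀ ε₁ r mv` is ANTITONE in the ball: it persists for smaller radii `ε₀' ≤ ε₀`, `ε₁' ≤ ε₁`, shorter range `r' ≤ r`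
   and smaller vertical window `mv' ≤ mv` (`AreaLawOnBall.anti`; the tier-1 ball is monotone in its radii — p1's `clusterDomainFR_mono` — and
   in its range, `IsSlabLocal` in its window).
2. THE RADIUS FUNCTION (K1-STATUS residual 3 in quantitative form).  rb-p2 g0's rows certify the ball at two couplings (`β_W = 1/3`, `1/2`).  Here:
   for `SU(2)` in EVERY dimension `d = n + 1 ≥ 2` and EVERY Wilson coupling of the window `0 ≤ β_W`, `n β_W < 2` of the cell's unconditional
   Wilson area law (`SlabAreaLawDimensions.su2_hasAreaLaw_of_lt_two`; `d = 4`: `β_W < 2/3`), the area law holds uniformly on the ball of radius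
     `ε(β_W) = (2 − n β_W)/10`, i.e. `AreaLawOnBall 2 (n+1) (β_W/2) (2ε(β_W)) (ε(β_W)) r mv` for every range `r` and window `mv ≥ 1`
   (`su2_areaLawOnBall_radius`; affine-vertex door of `RobustAreaLawVertex` on the quarter modulus, certificate `e^{x} ≤ 1 + x + x²` (`|x| ≤ 1`, Mathlib)
   and `√2 ≤ 1.415`).  So the robust ball has POSITIVE radius at every coupling strictly inside the Wilson window and the certified radius
   vanishes LINEARLY at the door's threshold `β_W = 2/n` — a door artefact, not a statement about the true extent of the confining phase
   (nothing is claimed at or beyond `2/n`).  The rows remain the better numbers where they exist (`d = 4`: `ε(1/3) = 0.10` here vs `0.15` certified,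
   `ε(1/2) = 0.05` vs `0.06`).
-/

noncomputable section

open MeasureTheory
open Literature.MathematicalPhysics.QuantumLattice (fundamentalRep)
open Literature.MathematicalPhysics.QuantumFieldTheory

namespace Summit.Ventures.YMGap.RobustBall

variable {d L N : ℕ}

/-! ### 1. Monotonicity -/

/-- A shorter range is a range. [folklore] -/
theorem HasRange.mono [NeZero L] {r r' : ℕ} (h : r ≤ r') {W : Perturbation d L N} (hW : HasRange r W) : HasRange r' W :=
  fun X hX => hW X (lt_of_le_of_lt h hX)

/-- The tier-1 ball grows with its range. [folklore] -/
theorem clusterDomainFR_mono_range [NeZero L] {ε₀ ε₁ : ℝ} {r r' : ℕ} (h : r ≤ r') :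
    (ClusterDomainFR ε₀ ε₁ r : Set (Perturbation d L N)) ⊆ ClusterDomainFR ε₀ ε₁ r' :=
  fun _ hW => ⟨HasRange.mono h hW.1, hW.2⟩

/-- A smaller vertical dependence diameter is a vertical dependence diameter. [folklore] -/
theorem HasVertRange.mono [NeZero L] {m m' : ℕ} (h : m ≤ m') {W : Perturbation d L N} (hW : HasVertRange m W) :
    HasVertRange m' W := by
  intro X v
  obtain ⟨t₀, ht₀⟩ := hW X v
  refine ⟨t₀, fun U V hUV => ht₀ fun e he => hUV e ?_⟩
  rcases he with he | ⟨k, hk, hke⟩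
  · exact Or.inl he
  · exact Or.inr ⟨k, lt_of_lt_of_le hk h, hke⟩

/-- `IsSlabLocal` is monotone in the window. [folklore] -/
theorem IsSlabLocal.mono [NeZero L] {m m' : ℕ} (h : m ≤ m') {W : Perturbation d L N} (hW : IsSlabLocal m W) : IsSlabLocal m' W :=
  ⟨hW.center_inv, hW.vert_range.mono h⟩

/-- **The area-law currency is antitone in the ball**: if Wilson's area law holds uniformly on `ClusterDomainFR ε₀ ε₁ r ∩ IsSlabLocal mv`, it
holds (with the same constants) on every smaller ball `ε₀' ≤ ε₀`, `ε₁' ≤ ε₁`, `r' ≤ r`, `mv' ≤ mv`. [folklore] -/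
theorem AreaLawOnBall.anti {β ε₀ ε₁ ε₀' ε₁' : ℝ} {r r' mv mv' : ℕ} (h : AreaLawOnBall N d β ε₀ ε₁ r mv)
    (h₀ : ε₀' ≤ ε₀) (h₁ : ε₁' ≤ ε₁) (hr : r' ≤ r) (hm : mv' ≤ mv) : AreaLawOnBall N d β ε₀' ε₁' r' mv' := by
  obtain ⟨C, c, hc, hA⟩ := h
  exact ⟨C, c, hc, fun L _ W hW hloc x i j R T hij hR hT hRL hTL =>
    hA L W (clusterDomainFR_mono h₀ h₁ (clusterDomainFR_mono_range hr hW)) (hloc.mono hm) x i j R T hij hR hT hRL hTL⟩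

/-! ### 2. The radius function on the whole `SU(2)` window -/

/-- **`SU(2)`, EVERY `d = n + 1`: THE RADIUS FUNCTION `ε(β_W) = (2 − n β_W)/10` ON THE WHOLE WILSON WINDOW.**  For `0 ≤ β_W` and `n β_W < 2`
(the window of the cell's unconditional `SU(2)` Wilson area law `su2_hasAreaLaw_of_lt_two`; `d = 4`: `β_W < 2/3`), Wilson's area law holds
uniformly on the tier-1 ball of radii `(ε₀, ε₁) = ((2 − nβ_W)/5, (2 − nβ_W)/10)`, every range `r`, every window `mv ≥ 1`:
`AreaLawOnBall 2 (n+1) (β_W/2) ((2 − nβ_W)/5) ((2 − nβ_W)/10) r mv`.  Proof: affine-vertex door on the quarter modulus (`c_W = nβ_W/2 = 1 − δ`,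
`ε₀ = 2δ/5`, `ε₁ = δ/5`): both vertices `e^{2δ/5}(1−δ)(1 + 2√2 δ/5)` and `e^{2δ/5}(1−δ) + √2 δ/5` are `< 1` for `0 < δ ≤ 1` by
`e^{x} ≤ 1 + x + x²`, `√2 ≤ 1.415` (leading terms `1 − 0.034δ`, `1 − 0.317δ`). [folklore] -/
theorem su2_areaLawOnBall_radius {n : ℕ} {βW : ℝ} (hβ : 0 ≤ βW) (hlt : (n : ℝ) * βW < 2) (r : ℕ) {mv : ℕ} (hmv : 1 ≤ mv) :
    AreaLawOnBall 2 (n + 1) (βW / 2) ((2 - n * βW) / 5) ((2 - n * βW) / 10) r mv := by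
  set δ : ℝ := 1 - n * βW / 2 with hδdef
  have hδ0 : 0 < δ := by rw [hδdef]; linarith
  have hδ1 : δ ≤ 1 := by
    rw [hδdef]; have : 0 ≤ (n : ℝ) * βW := mul_nonneg (Nat.cast_nonneg n) hβ; linarith
  have hε₀ : (2 - n * βW) / 5 = 2 * δ / 5 := by rw [hδdef]; ring
  have hε₁ : (2 - n * βW) / 10 = δ / 5 := by rw [hδdef]; ring
  have hmod := SlabAreaLawDimensions.su2_oneLinkKRModulus_of_le_one (R := n * βW / 2) (by linarith)
  have habs : |βW / 2 / ((2 : ℕ) : ℝ)| = βW / 4 := by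
    rw [abs_of_nonneg (by positivity)]; push_cast; ring
  have hcW : 2 * (n : ℝ) * |βW / 2 / ((2 : ℕ) : ℝ)| * 1 = 1 - δ := by rw [habs, hδdef]; ring
  -- the two certificates
  have hE : Real.exp (2 * δ / 5) ≤ 1 + 2 * δ / 5 + (2 * δ / 5) ^ 2 := by
    -- `e^{x} ≤ 1 + x + x²` for `|x| ≤ 1` (Mathlib `Real.abs_exp_sub_one_sub_id_le`)
    have h := Real.abs_exp_sub_one_sub_id_le (x := 2 * δ / 5) (by rw [abs_of_nonneg (by linarith)]; linarith)
    have := (abs_le.1 h).2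
    linarith
  have hE0 : 0 < Real.exp (2 * δ / 5) := Real.exp_pos _
  have hS := sqrt_two_le_1415
  have hS0 : 0 ≤ Real.sqrt 2 := Real.sqrt_nonneg _
  have hB : Real.exp (2 * δ / 5) * (1 - δ) ≤ (1 + 2 * δ / 5 + (2 * δ / 5) ^ 2) * (1 - δ) :=
    mul_le_mul_of_nonneg_right hE (by linarith)
  rw [hε₀, hε₁]
  refine areaLawOnBall_of_oneLinkKRModulus_vertex (n := n) le_rfl (βW / 2) zero_le_one hmod (by rw [habs]; linarith) r hmv ?_ ?_
  · -- vertex 1: `e^{2δ/5} (1−δ) (1 + 2√2 δ/5) < 1`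
    rw [hcW]
    have h2 : 1 + 2 * Real.sqrt 2 * (δ / 5) ≤ 1 + 2 * (1415 / 1000) * (δ / 5) := by nlinarith
    have h2' : 0 ≤ 1 + 2 * Real.sqrt 2 * (δ / 5) := by positivity
    calc Real.exp (2 * δ / 5) * (1 - δ) * (1 + 2 * Real.sqrt 2 * (δ / 5))
        ≤ (1 + 2 * δ / 5 + (2 * δ / 5) ^ 2) * (1 - δ) * (1 + 2 * (1415 / 1000) * (δ / 5)) :=
          mul_le_mul hB h2 h2' (by nlinarith)
      _ < 1 := by nlinarith [pow_pos hδ0 2, pow_pos hδ0 3, pow_pos hδ0 4]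
  · -- vertex 2: `e^{2δ/5} (1−δ) + √2 δ/5 < 1`
    rw [hcW]
    have h2 : Real.sqrt 2 * (δ / 5) ≤ 1415 / 1000 * (δ / 5) := mul_le_mul_of_nonneg_right hS (by linarith)
    nlinarith [pow_pos hδ0 2, pow_pos hδ0 3]

/-- The `d = 4` reading: for `0 ≤ β_W < 2/3`, `AreaLawOnBall 2 4 (β_W/2) ((2 − 3β_W)/5) ((2 − 3β_W)/10) r mv` — positive radius
`ε(β_W) = (2 − 3β_W)/10` at EVERY coupling of the cell's `d = 4` Wilson area-law window `β_W < 2/3`. [folklore] -/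
theorem su2_areaLawOnBall_radius_dim4 {βW : ℝ} (hβ : 0 ≤ βW) (hlt : βW < 2 / 3) (r : ℕ) {mv : ℕ} (hmv : 1 ≤ mv) :
    AreaLawOnBall 2 4 (βW / 2) ((2 - 3 * βW) / 5) ((2 - 3 * βW) / 10) r mv := by
  have h := su2_areaLawOnBall_radius (n := 3) hβ (by push_cast; linarith) r hmv
  push_cast at h
  exact h

/-- **Positive radius at every coupling of the window** (`SU(2)`, every `d = n + 1`): for `0 ≤ β_W`, `nβ_W < 2` there is `ε > 0` — namely
`ε = (2 − nβ_W)/10` — with `AreaLawOnBall 2 (n+1) (β_W/2) (2ε) ε r mv` for every range `r` and window `mv ≥ 1`, and (antitonicity) for every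
smaller one-parameter ball `0 ≤ ε' ≤ ε` as well. [folklore] -/
theorem su2_areaLawOnBall_exists_radius {n : ℕ} {βW : ℝ} (hβ : 0 ≤ βW) (hlt : (n : ℝ) * βW < 2) :
    ∃ ε : ℝ, 0 < ε ∧ ∀ ε' : ℝ, ε' ≤ ε → ∀ (r : ℕ) (mv : ℕ), 1 ≤ mv → AreaLawOnBall 2 (n + 1) (βW / 2) (2 * ε') ε' r mv := by
  refine ⟨(2 - n * βW) / 10, by linarith, fun ε' hε' r mv hmv => ?_⟩
  have h := su2_areaLawOnBall_radius (n := n) hβ hlt r hmv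
  exact h.anti (by linarith) hε' le_rfl le_rfl

end Summit.Ventures.YMGap.RobustBall

end
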